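import Summits.AtomisticToContinuum.Crystallization.Theses.EnergyDerivativeOrder
import Summits.AtomisticToContinuum.Crystallization.Theorems.EnergyDerivativeOrderDanskinStepHcpSums

/-!
# Route `EnergyDerivativeOrder`, item stmt-AtomisticToContinuum-12282 `DanskinStep`

`DirectionalRobustHcpBound → NondegenerateHcpOptimum → TrialUpperBound → ∃ hcp(a,h)` in the window
with (i′) [`IsLeast` among periodic configurations + `E(N)/N → e(hcp(a,h))`] and NO CORNER of the
ground-state energy per particle along every `C²` compactly supported test potential `W`:
for all `ε > 0` there is `t₀ > 0` with, for `t ∈ (0,t₀)`, eventually in `N`,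
`(E_{LJ+tW}(N) − E_LJ(N))/(tN) ≥ e_{hcp(a,h)}(W) − ε` and
`(E_LJ(N) − E_{LJ−tW}(N))/(tN) ≤ e_{hcp(a,h)}(W) + ε`.

Proof (elementary one-sided Danskin / envelope argument on the two-parameter hcp family; Danskin
1966, Bonnans–Shapiro Prop. 4.12, here with the argmin a singleton of quadratic growth):
take `(a,h) = (a₀,h₀)`, the certified nondegenerate optimum of (C3).

* (i′): (C1) at `t = 0`, `W = 0` gives eventually `E(N)/N ≥ e_{hcp(a',h')}(V_LJ) ≥ e₀` for some
  box point `(a',h')` (quadratic growth, C3), and `TrialUpperBound` gives eventually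
  `E(N)/N ≤ e(Q) + ε` for every periodic `Q`; hence `e₀ ≤ e(Q)` and `E(N)/N → e₀`.
* no corner: `e_{hcp}(V_LJ + tW) = e_{hcp}(V_LJ) + t·e_{hcp}(W)` (linearity, finite range of `W`),
  `(a,h) ↦ e_{hcp(a,h)}(W) = g(a,h)` is continuous and bounded by `M` on the box `[1/2,2]²`
  (`exists_continuous_hcp_energyPerParticle`); with `δ` from continuity of `g` at `(a₀,h₀)`
  (tolerance `ε/4`), `t₁` from (C1) (slack `ε/4`) and `t₀ = min t₁ (κδ²/(2M+1))`, for
  `0 < t < t₀` the witness `(a,h)` of (C1) at `±t` is either `δ`-close to `(a₀,h₀)` (continuity)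
  or pays `κδ² > t(2M+1)` (quadratic growth beats the bounded perturbation); together with
  `TrialUpperBound` at `Q = hcp(a₀,h₀)` with tolerance `εt/4` both difference quotients are pinched
  to `g(a₀,h₀) ± ε`.

Sources: J. M. Danskin, *The theory of max-min, with applications*, SIAM J. Appl. Math. 14 (1966),
doi:10.1137/0114053, Thm I; X. Blanc, M. Lewin, *The crystallization conjecture: a review*, EMS
Surv. Math. Sci. 2 (2015), §2.1.
-/

noncomputable section

namespace Summit.AtomisticToContinuum.Crystallization.Theorems

open Literature.MathematicalPhysics.StatisticalMechanics
open Summit.AtomisticToContinuum.Crystallization.Theses.EnergyDerivativeOrder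
open Summit.AtomisticToContinuum.Crystallization.Theorems.EnergyDerivativeOrderDanskin
open scoped BigOperators Topology
open Filter Set Metric

/-- **Item stmt-AtomisticToContinuum-12282 (`DanskinStep`, route `EnergyDerivativeOrder`).**
Directionally robust energetic crystallization onto the hcp family (C1), a nondegenerate optimal
relaxed hcp `(a₀,h₀)` with quadratic growth (C3) and the trial-state upper bound imply: `hcp(a₀,h₀)`
is least among periodic configurations for the Lennard-Jones energy per particle,
`E(N)/N → e(hcp(a₀,h₀))`, and the ground-state energy has no corner at `V_LJ` along every `C²`
compactly supported `W`, with slope `e_{hcp(a₀,h₀)}(W)` (one-sided elementary Danskin argument).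
[folklore] -/
theorem danskinStep_proof :
    Summit.AtomisticToContinuum.Crystallization.Theses.EnergyDerivativeOrder.DanskinStep := by
  unfold Summit.AtomisticToContinuum.Crystallization.Theses.EnergyDerivativeOrder.DanskinStep
  intro hC1 hC3 hTUB
  obtain ⟨a₀, h₀, ha₀, hh₀, ha₀I, hh₀I, hwin, κ, hκ, hgrow⟩ := hC3
  /- (*) eventually `e₀ ≤ E_LJ(N)/N`: (C1) at `t = 0`, `W = 0`, and quadratic growth -/
  have hlow : ∀ᶠ N : ℕ in atTop,
      (hcpPeriodicConfiguration ha₀ hh₀).energyPerParticle lennardJones ≤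
        groundStateEnergy lennardJones 3 N / N := by
    obtain ⟨t₀, ht₀, ht⟩ := hC1 (fun _ => (0 : ℝ)) contDiff_const
      (HasCompactSupport.zero : HasCompactSupport (0 : ℝ → ℝ)) 1 one_pos
    filter_upwards [ht 0 (by simpa using ht₀)] with N hN
    obtain ⟨a, h, ha, hh, haI, hhI, hle⟩ := hN
    have hle' : (hcpPeriodicConfiguration ha hh).energyPerParticle lennardJones ≤
        groundStateEnergy lennardJones 3 N / N := by simpa using hle
    have hg := hgrow a h ha hh haI hhI
    have hsq : 0 ≤ κ * ((a - a₀) ^ 2 + (h - h₀) ^ 2) := by positivity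
    linarith
  /- (i′a) `hcp(a₀,h₀)` is least among periodic configurations -/
  have hleast :
      IsLeast (Set.range fun Q : PeriodicConfiguration 3 => Q.energyPerParticle lennardJones)
      ((hcpPeriodicConfiguration ha₀ hh₀).energyPerParticle lennardJones) := by
    refine ⟨⟨hcpPeriodicConfiguration ha₀ hh₀, rfl⟩, ?_⟩
    rintro _ ⟨Q, rfl⟩
    refine le_of_forall_pos_le_add fun ε hε => ?_
    obtain ⟨N, hN1, hN2⟩ := (hlow.and (hTUB Q ε hε)).exists
    exact hN1.trans hN2
  /- (i′b) `E(N)/N → e₀` -/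
  have hlim : Tendsto (fun N : ℕ => groundStateEnergy lennardJones 3 N / N) atTop
      (𝓝 ((hcpPeriodicConfiguration ha₀ hh₀).energyPerParticle lennardJones)) := by
    rw [tendsto_order]
    refine ⟨fun b hb => hlow.mono fun N hN => hb.trans_le hN, fun b hb => ?_⟩
    have hε : 0 < (b - (hcpPeriodicConfiguration ha₀ hh₀).energyPerParticle lennardJones) / 2 := by
      linarith
    exact (hTUB (hcpPeriodicConfiguration ha₀ hh₀) _ hε).mono fun N hN => by linarith
  refine ⟨a₀, h₀, ha₀, hh₀, by linarith [ha₀I.1], hwin, hleast, hlim, ?_⟩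
  /- no corner along `W` -/
  intro W hW hWc ε hε
  obtain ⟨R, -, hR⟩ := exists_eq_zero_of_hasCompactSupport hWc
  obtain ⟨g, hgc, hg⟩ := exists_continuous_hcp_energyPerParticle hW.continuous hWc
  -- uniform bound `M₁` for `g` on the box
  obtain ⟨M, hM⟩ := (isCompact_Icc.prod isCompact_Icc :
      IsCompact (Set.Icc (1 / 2 : ℝ) 2 ×ˢ Set.Icc (1 / 2 : ℝ) 2)).exists_bound_of_continuousOn
    hgc.continuousOn
  set M₁ : ℝ := max M 1 with hM₁
  have hM₁pos : 0 < M₁ := lt_of_lt_of_le one_pos (le_max_right _ _)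
  have hgM : ∀ a h : ℝ, a ∈ Set.Icc (1 / 2 : ℝ) 2 → h ∈ Set.Icc (1 / 2 : ℝ) 2 → |g (a, h)| ≤ M₁ :=
    fun a h ha hh => by
      have h1 := hM (a, h) ⟨ha, hh⟩
      rw [Real.norm_eq_abs] at h1
      exact h1.trans (le_max_left _ _)
  -- continuity of `g` at `(a₀,h₀)` with tolerance `ε/4`
  obtain ⟨δ, hδ, hδg⟩ :=
    Metric.continuousAt_iff.1 (hgc.continuousAt (x := (a₀, h₀))) (ε / 4) (by positivity)
  have hnear : ∀ a h : ℝ, (a - a₀) ^ 2 + (h - h₀) ^ 2 < δ ^ 2 →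
      |g (a, h) - g (a₀, h₀)| < ε / 4 := by
    intro a h hd
    have h1 : |a - a₀| < δ := abs_lt_of_sq_lt_sq (by nlinarith [sq_nonneg (h - h₀)]) hδ.le
    have h2 : |h - h₀| < δ := abs_lt_of_sq_lt_sq (by nlinarith [sq_nonneg (a - a₀)]) hδ.le
    have h3 := hδg (x := (a, h)) (by
      rw [Prod.dist_eq, Real.dist_eq, Real.dist_eq]
      exact max_lt h1 h2)
    rwa [Real.dist_eq] at h3
  -- (C1) with slack `ε/4`, and the choice of `t₀`
  obtain ⟨t₁, ht₁, hC1W⟩ := hC1 W hW hWc (ε / 4) (by positivity)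
  refine ⟨min t₁ (κ * δ ^ 2 / (2 * M₁ + 1)), lt_min ht₁ (by positivity), fun t ht htlt => ?_⟩
  have htt₁ : t < t₁ := htlt.trans_le (min_le_left _ _)
  have htκ : t * (2 * M₁ + 1) < κ * δ ^ 2 := by
    have h1 := htlt.trans_le (min_le_right _ _)
    rwa [lt_div_iff₀ (by positivity)] at h1
  have hN : ∀ᶠ N : ℕ in atTop, (0 : ℝ) < N := by
    filter_upwards [eventually_gt_atTop 0] with N hN
    exact_mod_cast hN
  have hTUBt : ∀ᶠ N : ℕ in atTop, groundStateEnergy lennardJones 3 N / N ≤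
      (hcpPeriodicConfiguration ha₀ hh₀).energyPerParticle lennardJones + ε / 4 * t :=
    hTUB _ (ε / 4 * t) (by positivity)
  have hg₀ : (hcpPeriodicConfiguration ha₀ hh₀).energyPerParticle W = g (a₀, h₀) :=
    hg a₀ h₀ ha₀ hh₀ ha₀I.1 hh₀I.1
  -- linearity of the energy per particle along `V_LJ + sW` on the box
  have key : ∀ (a h : ℝ) (ha : a ≠ 0) (hh : h ≠ 0), a ∈ Set.Icc (1 / 2 : ℝ) 2 →
      h ∈ Set.Icc (1 / 2 : ℝ) 2 → ∀ s : ℝ,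
      (hcpPeriodicConfiguration ha hh).energyPerParticle (fun r => lennardJones r + s * W r) =
        (hcpPeriodicConfiguration ha hh).energyPerParticle lennardJones + s * g (a, h) := by
    intro a h ha hh haI hhI s
    rw [energyPerParticle_lennardJones_add_mul _ hR, hg a h ha hh haI.1 hhI.1]
  -- the Danskin dichotomy: `δ`-close (continuity) or far (quadratic growth beats `t·M₁`)
  have dich : ∀ a h : ℝ, a ∈ Set.Icc (1 / 2 : ℝ) 2 → h ∈ Set.Icc (1 / 2 : ℝ) 2 →
      t * (g (a₀, h₀) - ε / 4) ≤ κ * ((a - a₀) ^ 2 + (h - h₀) ^ 2) + t * g (a, h) ∧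
      t * g (a, h) - κ * ((a - a₀) ^ 2 + (h - h₀) ^ 2) ≤ t * (g (a₀, h₀) + ε / 4) := by
    intro a h haI hhI
    by_cases hd : (a - a₀) ^ 2 + (h - h₀) ^ 2 < δ ^ 2
    · have h1 := hnear a h hd
      rw [abs_lt] at h1
      have hk : 0 ≤ κ * ((a - a₀) ^ 2 + (h - h₀) ^ 2) := by positivity
      have p1 : t * (g (a₀, h₀) - ε / 4) ≤ t * g (a, h) :=
        mul_le_mul_of_nonneg_left (by linarith [h1.1]) ht.le
      have p2 : t * g (a, h) ≤ t * (g (a₀, h₀) + ε / 4) :=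
        mul_le_mul_of_nonneg_left (by linarith [h1.2]) ht.le
      constructor <;> linarith
    · rw [not_lt] at hd
      have h1 := hgM a h haI hhI
      have h2 := hgM a₀ h₀ ha₀I hh₀I
      rw [abs_le] at h1 h2
      have hk : κ * δ ^ 2 ≤ κ * ((a - a₀) ^ 2 + (h - h₀) ^ 2) :=
        mul_le_mul_of_nonneg_left hd hκ.le
      have p1 := mul_le_mul_of_nonneg_left h1.1 ht.le
      have p2 := mul_le_mul_of_nonneg_left h1.2 ht.le
      have p3 := mul_le_mul_of_nonneg_left h2.1 ht.le
      have p4 := mul_le_mul_of_nonneg_left h2.2 ht.le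
      have p5 : 0 < t * ε := mul_pos ht hε
      constructor <;> linarith
  constructor
  · /- (A) the right difference quotient: (C1) at `+t` and the trial bound at `hcp(a₀,h₀)` -/
    have hC1t := hC1W t (by rwa [abs_of_pos ht])
    filter_upwards [hC1t, hTUBt, hN] with N hN1 hN2 hNpos
    obtain ⟨a, h, ha, hh, haI, hhI, hle⟩ := hN1
    rw [key a h ha hh haI hhI t, abs_of_pos ht] at hle
    have hgr := hgrow a h ha hh haI hhI
    obtain ⟨hd1, -⟩ := dich a h haI hhI
    rw [hg₀, le_div_iff₀ (by positivity)]
    have h1 := (le_div_iff₀ hNpos).1 hle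
    have h2 := (div_le_iff₀ hNpos).1 hN2
    have q1 := mul_le_mul_of_nonneg_right hgr hNpos.le
    have q2 := mul_le_mul_of_nonneg_right hd1 hNpos.le
    have q3 : 0 < ε * t * (N : ℝ) := by positivity
    linarith
  · /- (B) the left difference quotient: (C1) at `−t` and the trial bound at `hcp(a₀,h₀)` -/
    have hC1t := hC1W (-t) (by rwa [abs_neg, abs_of_pos ht])
    have hV : (fun r => lennardJones r + -t * W r) = fun r => lennardJones r - t * W r := by
      funext r
      ring
    filter_upwards [hC1t, hTUBt, hN] with N hN1 hN2 hNpos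
    obtain ⟨a, h, ha, hh, haI, hhI, hle⟩ := hN1
    rw [key a h ha hh haI hhI (-t), abs_neg, abs_of_pos ht, hV] at hle
    have hgr := hgrow a h ha hh haI hhI
    obtain ⟨-, hd2⟩ := dich a h haI hhI
    rw [hg₀, div_le_iff₀ (by positivity)]
    have h1 := (le_div_iff₀ hNpos).1 hle
    have h2 := (div_le_iff₀ hNpos).1 hN2
    have q1 := mul_le_mul_of_nonneg_right hgr hNpos.le
    have q2 := mul_le_mul_of_nonneg_right hd2 hNpos.le
    have q3 : 0 < ε * t * (N : ℝ) := by positivity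
    linarith

end Summit.AtomisticToContinuum.Crystallization.Theorems

end
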